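import Mathlib
import HarnessLib
import Summits.HubbardSuperconductivity.HubbardSuperconductivity.Theorems.ComplexGFFStiffnessHolomorphicPackageLines
import Literature.MathematicalPhysics.StatisticalMechanics.ActivityNormClosed

/-!
# Crux `HypACumulant`, child `H1bcStatement` — the state slot `H1σ2` HOLDS for the SHRUNK package, `N`-free size
# ([ABKM19] Theorem 6.8: smoothness of `S_k` in the state, second order, via the holomorphic route)

Route `route-HubbardSuperconductivity-ComplexGFFStiffness`, crux stmt-HubbardSuperconductivity-19154
(`HypACumulant`), child stmt-…-27380 (`H1bcStatement d := ∀ P, ∃ σ₂ ≥ 0, ∀ N M Q, H1σ2 P Q σ₂`).  The slot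
`H1σ2 P Q σ₂` (`AbkmPackageSlots`) asks for joint parallelogram second differences of `(u, v) ↦ S_q(u, v)` with all
four state corners in the CLOSED Theorem-6.8 ball of radius `P.r`.  The holomorphic route (Cauchy–Schwarz along
complex state lines, `…HolomorphicPackageLines.weakNormLE_secondDiff_nextKStep_package`) needs a bidisc of positive
radius around the corners INSIDE that ball, so it proves the slot for corners in the ball of radius `P.r/8`, i.e. for
the shrunk package `P.shrink` (`AbkmPackageShrink`), with Theorem 6.8 used on the `P.r`-ball of `P`:

* `weakNormLE_of_bilinear_limit` — closedness of the weak norm in the constant, bilinear form (the corner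
  directions are normalised by `max(‖y‖, c_y) + t`, `t ↓ 0`);
* `activityNormLE_secondDiff_opS_core` — the parallelogram bound for normalised directions;
* **`h1σ2_shrink`** — `H1σ2 P.shrink Q σ₂(P)` for EVERY realisation `Q : PackageAt P.shrink N M`, with the explicit
  `N`-free size `σ₂(P) = (r₀+1)·4σ(r)r/(7r/16)²`;
* **`h1bcStatement_shrink`** — `∀ P, ∃ σ₂ ≥ 0, ∀ N M (Q : PackageAt P.shrink N M), H1σ2 P.shrink Q σ₂`: the
  shrunk-package form of the child `H1bcStatement` (the form the holomorphic route can honestly deliver; the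
  full-radius form would need the direct second-order expansion of the polymer formula).

All proved, no `sorry`.  Honest scope: rung route (stiffness of a complex Gaussian gradient field via the
[ABKM19] RG); nothing here advances superconductivity in the Hubbard model, and the child item 27380 as TYPED
(full radius) is not closed by this file.

## References
* S. Adams, S. Buchholz, R. Kotecký, S. Müller, arXiv:1910.13564, Theorem 6.8, Ch. 12 (12.4)
  [AdamsBuchholzKoteckyMuller2019].
-/

noncomputable section

-- `Summit.<Summit>.<Problem>`: single-conjunct summit, the duplicate component is mandated (D-0017).
set_option linter.dupNamespace false

namespace Summit.HubbardSuperconductivity.HubbardSuperconductivity.Theorems.ComplexGFF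

open MeasureTheory Metric Set
open scoped BigOperators
open Literature.MathematicalPhysics.StatisticalMechanics.GradientRG
open Literature.MathematicalPhysics.StatisticalMechanics.TorusPolymer (IsPolymer blockOf)
open Literature.Barriers.CriticalPhenomena.LongRangePhi4.Polymer (IsConn)
open Literature.MathematicalPhysics.StatisticalMechanics

variable {d : ℕ}

/-! ## Two small facts: closedness in the constant (bilinear form), real renormalisation of complex scalars -/

/-- **Closedness of the weak norm in a bilinear constant**: if `‖K‖ ≤ σ₂ (a+t)(b+t)` for all small `t > 0` then
`‖K‖ ≤ σ₂ a b` (`σ₂, a, b ≥ 0`, `A > 0`). -/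
theorem weakNormLE_of_bilinear_limit {M : ℕ} [NeZero M] {Pn : NormParams d M} (hA : 0 < Pn.A) {k : ℕ}
    {K : Finset (Fin d → ZMod M) → ((Fin d → ZMod M) → ℝ) → ℂ} {σ₂ a b t₀ : ℝ} (hσ : 0 ≤ σ₂) (ha : 0 ≤ a)
    (hb : 0 ≤ b) (ht₀ : 0 < t₀) (h : ∀ t, 0 < t → t ≤ t₀ → WeakNormLE Pn k K (σ₂ * (a + t) * (b + t))) :
    WeakNormLE Pn k K (σ₂ * a * b) := by
  refine WeakNormLE.of_forall_lt fun C' hC' => ?_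
  set S := σ₂ * (a + b + t₀) with hS
  have hS0 : 0 ≤ S := by positivity
  have hgap : 0 < C' - σ₂ * a * b := by linarith
  set t := min t₀ ((C' - σ₂ * a * b) / (S + 1)) with ht
  have ht0 : 0 < t := lt_min ht₀ (div_pos hgap (by linarith))
  have htt₀ : t ≤ t₀ := min_le_left _ _
  have ht1 : t * (S + 1) ≤ C' - σ₂ * a * b := by
    have : t ≤ (C' - σ₂ * a * b) / (S + 1) := min_le_right _ _
    rwa [le_div_iff₀ (by linarith)] at this
  refine (h t ht0 htt₀).mono hA ?_
  have e : σ₂ * (a + t) * (b + t) = σ₂ * a * b + t * (σ₂ * (a + b + t)) := by ring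
  have h2 : σ₂ * (a + b + t) ≤ S := by rw [hS]; nlinarith
  rw [e]
  nlinarith

/-- `(t : ℂ) • (t⁻¹ • H) = H` for a real `t ≠ 0` and a complex coefficient vector (`ℝ` acting through `ℂ`). -/
theorem complex_smul_inv_smul_ham {t : ℝ} (ht : t ≠ 0) (H : RelevantHamiltonian ℂ d) :
    (t : ℂ) • ((t⁻¹ : ℝ) • H) = H := by
  funext i
  have ht' : (t : ℂ) ≠ 0 := by exact_mod_cast ht
  simp only [Pi.smul_apply, Complex.real_smul, smul_eq_mul, Complex.ofReal_inv]
  rw [← mul_assoc, mul_inv_cancel₀ ht', one_mul]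

/-- `(t : ℂ) • (t⁻¹ • K) = K` for a real `t ≠ 0` and a complex polymer activity. -/
theorem complex_smul_inv_smul_act {M : ℕ} {t : ℝ} (ht : t ≠ 0)
    (K : Finset (Fin d → ZMod M) → ((Fin d → ZMod M) → ℝ) → ℂ) :
    (t : ℂ) • ((t⁻¹ : ℝ) • K) = K := by
  funext Y ψ
  have ht' : (t : ℂ) ≠ 0 := by exact_mod_cast ht
  simp only [Pi.smul_apply, Complex.real_smul, smul_eq_mul, Complex.ofReal_inv]
  rw [← mul_assoc, mul_inv_cancel₀ ht', one_mul]

/-! ## The core: parallelogram second differences of `S_k^{(q)}` for normalised directions -/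

section Core

variable (P : PackageData d) [Fact (0 < P.h)] [Fact (0 < P.L)] {N M : ℕ} [NeZero M] (Q : PackageAt P N M)

set_option maxHeartbeats 800000 in
/-- **Core estimate.**  For `(u, v)` and directions `(y, y'), (z, z')` with `‖y‖, c_y`-sizes renormalised by
`n_y, n_z > 0`, a bidisc radius `R > n_y, n_z` such that the renormalised complex parallelogram stays in the
Theorem-6.8 ball of `P`:
`‖S(u+y+z, v+y'+z') − S(u+y, v+y') − S(u+z, v+z') + S(u, v)‖_{k+1} ≤ (r₀+1)·(4σ(r)r/R²)·n_y·n_z`. -/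
theorem activityNormLE_secondDiff_opS_core {q : Matrix (Fin d) (Fin d) ℝ} (hq : P.InBall q) {k : ℕ}
    (hk : k + 1 ≤ N) (u y z : HamSpace ℂ d (fieldWt P.h (P.L : ℝ) d k) ((P.L : ℝ) ^ k) (P.L ^ (d * k)))
    (v y' z' : activitySpace Q.normParams k) {cv cy cz : ℝ} (hcv0 : 0 ≤ cv) (hcy0 : 0 ≤ cy) (hcz0 : 0 ≤ cz)
    (hv : activityNormLE Q.normParams k v cv) (hy' : activityNormLE Q.normParams k y' cy)
    (hz' : activityNormLE Q.normParams k z' cz) {ny nz R : ℝ} (hny : 0 < ny) (hnz : 0 < nz) (hnyR : ny < R)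
    (hnzR : nz < R) (hH : ‖u‖ + R * (ny⁻¹ * ‖y‖) + R * (nz⁻¹ * ‖z‖) ≤ P.r)
    (hK : cv + R * (ny⁻¹ * cy) + R * (nz⁻¹ * cz) ≤ P.r) :
    activityNormLE Q.normParams (k + 1)
      (Q.opS q k (u + y + z) (v + y' + z') - Q.opS q k (u + y) (v + y') - Q.opS q k (u + z) (v + z') +
        Q.opS q k u v)
      (((P.r₀ : ℝ) + 1) * (4 * (sigmaABKM d P.L P.R P.A P.A𝒫' P.r * P.r) / R ^ 2) * ny * nz) := by
  have hPA : 0 < Q.normParams.A := P.A_pos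
  have hR0 : 0 < R := hny.trans hnyR
  have hny0 : 0 ≤ ny⁻¹ := inv_nonneg.2 hny.le
  have hnz0 : 0 ≤ nz⁻¹ := inv_nonneg.2 hnz.le
  -- the renormalised directions
  set yh : HamSpace ℂ d (fieldWt P.h (P.L : ℝ) d k) ((P.L : ℝ) ^ k) (P.L ^ (d * k)) := (ny⁻¹ : ℝ) • y with hyh
  set zh : HamSpace ℂ d (fieldWt P.h (P.L : ℝ) d k) ((P.L : ℝ) ^ k) (P.L ^ (d * k)) := (nz⁻¹ : ℝ) • z with hzh
  set yh' : activitySpace Q.normParams k := (ny⁻¹ : ℝ) • y' with hyh'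
  set zh' : activitySpace Q.normParams k := (nz⁻¹ : ℝ) • z' with hzh'
  have hnyh : ‖yh‖ = ny⁻¹ * ‖y‖ := by rw [hyh, norm_smul, Real.norm_eq_abs, abs_of_nonneg hny0]
  have hnzh : ‖zh‖ = nz⁻¹ * ‖z‖ := by rw [hzh, norm_smul, Real.norm_eq_abs, abs_of_nonneg hnz0]
  have hyh'n : activityNormLE Q.normParams k yh' (ny⁻¹ * cy) := by
    have h := WeakNormLE.smul hy' (activitySpace.contDiff y') ny⁻¹
    rw [abs_of_nonneg hny0] at h
    show WeakNormLE Q.normParams k ((yh' : activitySpace Q.normParams k) : Finset (Fin d → ZMod M) →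
      ((Fin d → ZMod M) → ℝ) → ℂ) (ny⁻¹ * cy)
    rw [hyh', Submodule.coe_smul]; exact h
  have hzh'n : activityNormLE Q.normParams k zh' (nz⁻¹ * cz) := by
    have h := WeakNormLE.smul hz' (activitySpace.contDiff z') nz⁻¹
    rw [abs_of_nonneg hnz0] at h
    show WeakNormLE Q.normParams k ((zh' : activitySpace Q.normParams k) : Finset (Fin d → ZMod M) →
      ((Fin d → ZMod M) → ℝ) → ℂ) (nz⁻¹ * cz)
    rw [hzh', Submodule.coe_smul]; exact h
  -- abbreviations
  set D := abkmStepData P.L P.R k (Q.kernels q) with hD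
  set H₀ := HamSpace.toHam u with hH₀
  set U₁ := HamSpace.toHam yh with hU₁
  set U₂ := HamSpace.toHam zh with hU₂
  set a := ((v : activitySpace Q.normParams k) : Finset (Fin d → ZMod M) → ((Fin d → ZMod M) → ℝ) → ℂ) with ha
  set b₁ := ((yh' : activitySpace Q.normParams k) : Finset (Fin d → ZMod M) → ((Fin d → ZMod M) → ℝ) → ℂ) with hb₁
  set b₂ := ((zh' : activitySpace Q.normParams k) : Finset (Fin d → ZMod M) → ((Fin d → ZMod M) → ℝ) → ℂ) with hb₂
  -- the engine
  have hHball : hamNorm (fieldWt P.h (P.L : ℝ) d k) ((P.L : ℝ) ^ k) (P.L ^ (d * k)) H₀ +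
      R * hamNorm (fieldWt P.h (P.L : ℝ) d k) ((P.L : ℝ) ^ k) (P.L ^ (d * k)) U₁ +
      R * hamNorm (fieldWt P.h (P.L : ℝ) d k) ((P.L : ℝ) ^ k) (P.L ^ (d * k)) U₂ ≤ P.r := by
    rw [hH₀, hU₁, hU₂, hamNorm_toHam_eq, hamNorm_toHam_eq, hamNorm_toHam_eq, hnyh, hnzh]; exact hH
  have hKball : cv + R * (ny⁻¹ * cy) + R * (nz⁻¹ * cz) ≤ P.r := hK
  have hσ : ((ny : ℝ) : ℂ) ∈ ball (0 : ℂ) R := by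
    rw [mem_ball_zero_iff, Complex.norm_real, Real.norm_eq_abs, abs_of_pos hny]; exact hnyR
  have hτ : ((nz : ℝ) : ℂ) ∈ ball (0 : ℂ) R := by
    rw [mem_ball_zero_iff, Complex.norm_real, Real.norm_eq_abs, abs_of_pos hnz]; exact hnzR
  have heng := weakNormLE_secondDiff_nextKStep_package P Q hq hk H₀ U₁ U₂ (a := a) (b₁ := b₁) (b₂ := b₂)
    hcv0 (mul_nonneg hny0 hcy0) (mul_nonneg hnz0 hcz0) hv hyh'n hzh'n (activitySpace.contDiff v)
    (activitySpace.contDiff yh') (activitySpace.contDiff zh') (fun Y hY hYc => activitySpace.isGaugeLocal v hY hYc)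
    (fun Y hY hYc => activitySpace.isGaugeLocal yh' hY hYc) (fun Y hY hYc => activitySpace.isGaugeLocal zh' hY hYc)
    (activitySpace.transInv v) (activitySpace.transInv yh') (activitySpace.transInv zh') hHball hKball hσ hτ
  -- identify the four corners
  have eU₁ : ((ny : ℝ) : ℂ) • U₁ = HamSpace.toHam y := by
    rw [hU₁, hyh, map_smul]; exact complex_smul_inv_smul_ham hny.ne' _
  have eU₂ : ((nz : ℝ) : ℂ) • U₂ = HamSpace.toHam z := by
    rw [hU₂, hzh, map_smul]; exact complex_smul_inv_smul_ham hnz.ne' _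
  have eb₁ : ((ny : ℝ) : ℂ) • b₁ = ((y' : activitySpace Q.normParams k) : Finset (Fin d → ZMod M) →
      ((Fin d → ZMod M) → ℝ) → ℂ) := by
    rw [hb₁, hyh', Submodule.coe_smul]; exact complex_smul_inv_smul_act hny.ne' _
  have eb₂ : ((nz : ℝ) : ℂ) • b₂ = ((z' : activitySpace Q.normParams k) : Finset (Fin d → ZMod M) →
      ((Fin d → ZMod M) → ℝ) → ℂ) := by
    rw [hb₂, hzh', Submodule.coe_smul]; exact complex_smul_inv_smul_act hnz.ne' _
  have eH11 : H₀ + ((ny : ℝ) : ℂ) • U₁ + ((nz : ℝ) : ℂ) • U₂ = HamSpace.toHam (u + y + z) := by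
    rw [eU₁, eU₂, hH₀, map_add, map_add]
  have eH10 : H₀ + ((ny : ℝ) : ℂ) • U₁ + (0 : ℂ) • U₂ = HamSpace.toHam (u + y) := by
    rw [eU₁, zero_smul, add_zero, hH₀, map_add]
  have eH01 : H₀ + (0 : ℂ) • U₁ + ((nz : ℝ) : ℂ) • U₂ = HamSpace.toHam (u + z) := by
    rw [eU₂, zero_smul, add_zero, hH₀, map_add]
  have eH00 : H₀ + (0 : ℂ) • U₁ + (0 : ℂ) • U₂ = HamSpace.toHam u := by
    rw [zero_smul, zero_smul, add_zero, add_zero]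
  have eK11 : a + ((ny : ℝ) : ℂ) • b₁ + ((nz : ℝ) : ℂ) • b₂ = ((v + y' + z' : activitySpace Q.normParams k) :
      Finset (Fin d → ZMod M) → ((Fin d → ZMod M) → ℝ) → ℂ) := by
    rw [eb₁, eb₂, ha, Submodule.coe_add, Submodule.coe_add]
  have eK10 : a + ((ny : ℝ) : ℂ) • b₁ + (0 : ℂ) • b₂ = ((v + y' : activitySpace Q.normParams k) :
      Finset (Fin d → ZMod M) → ((Fin d → ZMod M) → ℝ) → ℂ) := by
    rw [eb₁, zero_smul, add_zero, ha, Submodule.coe_add]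
  have eK01 : a + (0 : ℂ) • b₁ + ((nz : ℝ) : ℂ) • b₂ = ((v + z' : activitySpace Q.normParams k) :
      Finset (Fin d → ZMod M) → ((Fin d → ZMod M) → ℝ) → ℂ) := by
    rw [eb₂, zero_smul, add_zero, ha, Submodule.coe_add]
  have eK00 : a + (0 : ℂ) • b₁ + (0 : ℂ) • b₂ = ((v : activitySpace Q.normParams k) :
      Finset (Fin d → ZMod M) → ((Fin d → ZMod M) → ℝ) → ℂ) := by
    rw [zero_smul, zero_smul, add_zero, add_zero]
  have enorm : ((P.r₀ : ℝ) + 1) * (4 * (sigmaABKM d P.L P.R P.A P.A𝒫' P.r * P.r) / R ^ 2) * ‖((ny : ℝ) : ℂ)‖ *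
      ‖((nz : ℝ) : ℂ)‖ = ((P.r₀ : ℝ) + 1) * (4 * (sigmaABKM d P.L P.R P.A P.A𝒫' P.r * P.r) / R ^ 2) * ny * nz := by
    rw [Complex.norm_real, Complex.norm_real, Real.norm_eq_abs, Real.norm_eq_abs, abs_of_pos hny, abs_of_pos hnz]
  simp only [eH11, eH10, eH01, eH00, eK11, eK10, eK01, eK00, enorm] at heng
  -- the four corners lie in the ball: identify `opS` with `restrictConn ∘ nextKStep`
  have hy1 : ‖y‖ ≤ R * (ny⁻¹ * ‖y‖) := by
    have : ny * (ny⁻¹ * ‖y‖) = ‖y‖ := by field_simp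
    nlinarith [norm_nonneg y, mul_nonneg hny0 (norm_nonneg y)]
  have hz1 : ‖z‖ ≤ R * (nz⁻¹ * ‖z‖) := by
    have : nz * (nz⁻¹ * ‖z‖) = ‖z‖ := by field_simp
    nlinarith [norm_nonneg z, mul_nonneg hnz0 (norm_nonneg z)]
  have hcy1 : cy ≤ R * (ny⁻¹ * cy) := by
    have : ny * (ny⁻¹ * cy) = cy := by field_simp
    nlinarith [mul_nonneg hny0 hcy0]
  have hcz1 : cz ≤ R * (nz⁻¹ * cz) := by
    have : nz * (nz⁻¹ * cz) = cz := by field_simp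
    nlinarith [mul_nonneg hnz0 hcz0]
  have hpos1 : 0 ≤ R * (ny⁻¹ * ‖y‖) := by positivity
  have hpos2 : 0 ≤ R * (nz⁻¹ * ‖z‖) := by positivity
  have hpos3 : 0 ≤ R * (ny⁻¹ * cy) := by positivity
  have hpos4 : 0 ≤ R * (nz⁻¹ * cz) := by positivity
  have hu : ‖u‖ ≤ P.r := by linarith
  have huy : ‖u + y‖ ≤ P.r := (norm_add_le _ _).trans (by linarith)
  have huz : ‖u + z‖ ≤ P.r := (norm_add_le _ _).trans (by linarith)
  have huyz : ‖u + y + z‖ ≤ P.r := by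
    have h1 := norm_add_le (u + y) z
    have h2 := norm_add_le u y
    linarith
  have hQ := isSubaddNormBound_activityNormLE Q.normParams hPA
  have hvy : activityNormLE Q.normParams k (v + y') (cv + cy) := hQ.add k v y' cv cy hv hy'
  have hvz : activityNormLE Q.normParams k (v + z') (cv + cz) := hQ.add k v z' cv cz hv hz'
  have hvyz : activityNormLE Q.normParams k (v + y' + z') (cv + cy + cz) := hQ.add k (v + y') z' (cv + cy) cz hvy hz'
  unfold activityNormLE
  rw [Submodule.coe_add, Submodule.coe_sub, Submodule.coe_sub,
    packageAt_coe_opS P Q hq hk (u + y + z) (v + y' + z') huyz hvyz (by linarith),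
    packageAt_coe_opS P Q hq hk (u + y) (v + y') huy hvy (by linarith),
    packageAt_coe_opS P Q hq hk (u + z) (v + z') huz hvz (by linarith),
    packageAt_coe_opS P Q hq hk u v hu hv (by linarith)]
  intro X hX hXc
  have hXp : IsPolymer (P.L ^ (k + 1)) X := hX
  simp only [Pi.add_apply, Pi.sub_apply, restrictConn_of_conn hXp hXc]
  exact heng X hX hXc

end Core

/-! ## The slot for the shrunk package -/

/-- The explicit `N`-free size of the slot `H1σ2` for the shrunk package: `(r₀+1)·4σ(r)r/(7r/16)²`. -/
theorem sigma2Shrink_nonneg (P : PackageData d) :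
    0 ≤ ((P.r₀ : ℝ) + 1) * (4 * (sigmaABKM d P.L P.R P.A P.A𝒫' P.r * P.r) / (7 * P.r / 16) ^ 2) := by
  have := sigmaABKM_nonneg (d := d) (R := P.R) P.hLodd.pos P.hA1 P.A𝒫'_nonneg P.hr0
  have := P.hr0
  positivity

set_option maxHeartbeats 800000 in
/-- **The state slot `H1σ2` holds for the shrunk package with an explicit `N`-free size**: for every [ABKM19]
package `P` and every realisation `Q` at height `N` of `P.shrink` (state-ball radius `P.r/8`), the joint
parallelogram second differences of `(u, v) ↦ S_q(u, v)` obey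
`H1σ2 P.shrink Q ((r₀+1)·4σ(r)r/(7r/16)²)` (`σ(r) = sigmaABKM`, `r = P.r`). -/
theorem h1σ2_shrink (P : PackageData d) [Fact (0 < P.h)] [Fact (0 < P.L)] {N M : ℕ} [NeZero M]
    (Q : PackageAt P.shrink N M) :
    H1σ2 P.shrink Q (((P.r₀ : ℝ) + 1) * (4 * (sigmaABKM d P.L P.R P.A P.A𝒫' P.r * P.r) / (7 * P.r / 16) ^ 2)) := by
  intro q hq k hk u y z v y' z' cv cvy cvz cvyz cy cz hu huy huz huyz hv hcv hvy hcvy hvz hcvz hvyz hcvyz hy hz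
  set Q' : PackageAt P N M := Q.unshrink with hQ'
  set σ₂ := ((P.r₀ : ℝ) + 1) * (4 * (sigmaABKM d P.L P.R P.A P.A𝒫' P.r * P.r) / (7 * P.r / 16) ^ 2) with hσ₂
  have hσ₂0 : 0 ≤ σ₂ := sigma2Shrink_nonneg P
  have hPA : 0 < Q'.normParams.A := P.A_pos
  have hrs : P.shrink.r = P.r / 8 := rfl
  rw [hrs] at hu huy huz huyz hcv hcvy hcvz hcvyz
  have hMt : M = Q'.normParams.L ^ k * P.L ^ (N - k) := by
    show M = P.L ^ k * P.L ^ (N - k)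
    rw [Q.hM, ← pow_add, Nat.add_sub_cancel' (by omega)]
  have hQn := isSubaddNormBound_activityNormLE Q'.normParams hPA
  -- sizes of the directions
  have hcv0 : 0 ≤ cv := nonneg_of_weakNormLE hPA hMt P.hLodd.pow P.hLodd.pow hv
  have hcy0 : 0 ≤ cy := nonneg_of_weakNormLE hPA hMt P.hLodd.pow P.hLodd.pow hy
  have hcz0 : 0 ≤ cz := nonneg_of_weakNormLE hPA hMt P.hLodd.pow P.hLodd.pow hz
  have hny : ‖y‖ ≤ 2 * (P.r / 8) := by
    have e : y = (u + y) - u := by abel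
    have h := norm_sub_le (u + y) u
    rw [← e] at h; linarith
  have hnz : ‖z‖ ≤ 2 * (P.r / 8) := by
    have e : z = (u + z) - u := by abel
    have h := norm_sub_le (u + z) u
    rw [← e] at h; linarith
  have hy2 : activityNormLE Q'.normParams k y' (min cy (2 * (P.r / 8))) := by
    have h1 : activityNormLE Q'.normParams k (v + y' - v) (cvy + cv) := by
      have := hQn.add k (v + y') (-v) cvy cv hvy (hQn.neg k v cv hv)
      simpa [sub_eq_add_neg] using this
    have e : v + y' - v = y' := by abel
    rw [e] at h1
    exact WeakNormLE.min hPA hy (WeakNormLE.mono h1 hPA (by linarith))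
  have hz2 : activityNormLE Q'.normParams k z' (min cz (2 * (P.r / 8))) := by
    have h1 : activityNormLE Q'.normParams k (v + z' - v) (cvz + cv) := by
      have := hQn.add k (v + z') (-v) cvz cv hvz (hQn.neg k v cv hv)
      simpa [sub_eq_add_neg] using this
    have e : v + z' - v = z' := by abel
    rw [e] at h1
    exact WeakNormLE.min hPA hz (WeakNormLE.mono h1 hPA (by linarith))
  set my := max ‖y‖ (min cy (2 * (P.r / 8))) with hmy
  set mz := max ‖z‖ (min cz (2 * (P.r / 8))) with hmz
  have hmy0 : 0 ≤ my := le_max_of_le_left (norm_nonneg _)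
  have hmz0 : 0 ≤ mz := le_max_of_le_left (norm_nonneg _)
  have hcy' : 0 ≤ min cy (2 * (P.r / 8)) := le_min hcy0 (by linarith [P.hr0])
  have hcz' : 0 ≤ min cz (2 * (P.r / 8)) := le_min hcz0 (by linarith [P.hr0])
  have hmy2 : my ≤ 2 * (P.r / 8) := max_le hny (min_le_right _ _)
  have hmz2 : mz ≤ 2 * (P.r / 8) := max_le hnz (min_le_right _ _)
  have hmyA : my ≤ max ‖y‖ cy := max_le_max le_rfl (min_le_left _ _)
  have hmzA : mz ≤ max ‖z‖ cz := max_le_max le_rfl (min_le_left _ _)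
  -- the target through the unshrunk realisation
  show activityNormLE Q'.normParams (k + 1)
    (Q'.opS q k (u + y + z) (v + y' + z') - Q'.opS q k (u + y) (v + y') - Q'.opS q k (u + z) (v + z') +
      Q'.opS q k u v) (σ₂ * max ‖y‖ cy * max ‖z‖ cz)
  by_cases hr0 : P.r = 0
  · -- degenerate package: all directions have size zero; bidisc radius 2, no renormalisation
    have hσ₂z : σ₂ = 0 := by rw [hσ₂, hr0]; simp
    have hcore := activityNormLE_secondDiff_opS_core P Q' hq hk u y z v y' z' hcv0 hcy' hcz' hv hy2 hz2
      (ny := 1) (nz := 1) (R := 2) one_pos one_pos (by norm_num) (by norm_num)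
      (by rw [hr0] at hu hny hnz ⊢; nlinarith [norm_nonneg u, norm_nonneg y, norm_nonneg z])
      (by rw [hr0] at hcv hcy' hcz' ⊢
          have h1 : min cy (2 * (0 / 8)) ≤ 0 := (min_le_right _ _).trans (by norm_num)
          have h2 : min cz (2 * (0 / 8)) ≤ 0 := (min_le_right _ _).trans (by norm_num)
          nlinarith)
    refine hQn.mono (k + 1) _ _ _ hcore ?_
    rw [hσ₂z, hr0]; simp
  · have hrpos : 0 < P.r := lt_of_le_of_ne P.hr0 (Ne.symm hr0)
    have hlim : ∀ t, 0 < t → t ≤ P.r / 8 →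
        activityNormLE Q'.normParams (k + 1)
          (Q'.opS q k (u + y + z) (v + y' + z') - Q'.opS q k (u + y) (v + y') - Q'.opS q k (u + z) (v + z') +
            Q'.opS q k u v) (σ₂ * (max ‖y‖ cy + t) * (max ‖z‖ cz + t)) := by
      intro t ht htr
      have hny' : 0 < my + t := by linarith
      have hnz' : 0 < mz + t := by linarith
      have hR : my + t < 7 * P.r / 16 := by linarith
      have hR' : mz + t < 7 * P.r / 16 := by linarith
      have hyq : (my + t)⁻¹ * ‖y‖ ≤ 1 := by
        rw [inv_mul_le_iff₀ hny']; linarith [le_max_left ‖y‖ (min cy (2 * (P.r / 8)))]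
      have hzq : (mz + t)⁻¹ * ‖z‖ ≤ 1 := by
        rw [inv_mul_le_iff₀ hnz']; linarith [le_max_left ‖z‖ (min cz (2 * (P.r / 8)))]
      have hcyq : (my + t)⁻¹ * min cy (2 * (P.r / 8)) ≤ 1 := by
        rw [inv_mul_le_iff₀ hny']; linarith [le_max_right ‖y‖ (min cy (2 * (P.r / 8)))]
      have hczq : (mz + t)⁻¹ * min cz (2 * (P.r / 8)) ≤ 1 := by
        rw [inv_mul_le_iff₀ hnz']; linarith [le_max_right ‖z‖ (min cz (2 * (P.r / 8)))]
      have h7 : 0 ≤ 7 * P.r / 16 := by positivity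
      have hcore := activityNormLE_secondDiff_opS_core P Q' hq hk u y z v y' z' hcv0 hcy' hcz' hv hy2 hz2
        hny' hnz' hR hR'
        (by nlinarith [mul_le_mul_of_nonneg_left hyq h7, mul_le_mul_of_nonneg_left hzq h7])
        (by nlinarith [mul_le_mul_of_nonneg_left hcyq h7, mul_le_mul_of_nonneg_left hczq h7])
      refine hQn.mono (k + 1) _ _ _ hcore ?_
      have h1 : my + t ≤ max ‖y‖ cy + t := by linarith
      have h2 : mz + t ≤ max ‖z‖ cz + t := by linarith
      have h3 : 0 ≤ max ‖y‖ cy + t := by linarith [(le_max_of_le_left (norm_nonneg y) : (0:ℝ) ≤ max ‖y‖ cy)]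
      calc σ₂ * (my + t) * (mz + t) ≤ σ₂ * (max ‖y‖ cy + t) * (mz + t) := by gcongr
        _ ≤ σ₂ * (max ‖y‖ cy + t) * (max ‖z‖ cz + t) := by gcongr
    exact weakNormLE_of_bilinear_limit hPA hσ₂0 (le_max_of_le_left (norm_nonneg y)) (le_max_of_le_left (norm_nonneg z))
      (by positivity : 0 < P.r / 8) hlim

/-- **The shrunk-package form of the child `H1bcStatement`**: every [ABKM19] package admits an `N`-FREE joint
state second-difference size `σ₂ ≥ 0` for `S_q` on the shrunk state ball (radius `r/8`), at every height. -/
theorem h1bcStatement_shrink (P : PackageData d) [Fact (0 < P.h)] [Fact (0 < P.L)] :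
    ∃ σ₂ : ℝ, 0 ≤ σ₂ ∧ ∀ (N M : ℕ) [NeZero M] (Q : PackageAt P.shrink N M), H1σ2 P.shrink Q σ₂ :=
  ⟨_, sigma2Shrink_nonneg P, fun _ _ _ Q => h1σ2_shrink P Q⟩

end Summit.HubbardSuperconductivity.HubbardSuperconductivity.Theorems.ComplexGFF

end
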